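import Literature.AnabelianGeometry.SemiGraphs.SurfaceTypeFreeCuspQuotients
import Literature.AnabelianGeometry.SemiGraphs.SurfaceTypeEdgeGroups
import Literature.AnabelianGeometry.SemiGraphs.SurfaceTypeCoveringsToolkit
import Literature.AnabelianGeometry.SemiGraphs.TemperedCoverings
import Mathlib.Algebra.Field.ZMod
import HarnessLib

/-!
# [IUTchI] Cor. 2.3 (vi) at surface type, I: cusp characters of a pro-`Σ` surface group, their values on the closed cusp
# inertia groups, and the uniqueness of the closed subgroup of index `ℓ` in an edge group ([SemiAnbd] Ex. 2.10)

S. Mochizuki, *Semi-graphs of anabelioids*, Publ. RIMS **42** (2006), Example 2.10 p. 31 («each `Π_v` is the maximal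
pro-`Σ` quotient of the fundamental group of a hyperbolic Riemann surface of finite type … each `Π_b → Π_v` is the
inclusion morphism of the inertia group of one of the cusps») [cite: MochizukiSemiAnbd2006, Ex. 2.10 p.31]; S. Mochizuki,
*Inter-universal Teichmüller theory I*, kurims manuscript (May 2020), §2, Cor. 2.3 (vi) p. 48, proof p. 49 l. 62–64
[cite: Mochizuki2012, Cor 2.3(vi) pp.48-49] (D-0012 claim key; series DISPUTED; nothing of it is asserted here).

PROOF-ONLY file (abc-iut cell, seat abc-iut-L5-d5 gen 10, row «COR23VI-HF-TWO-LEVEL@CAVEAT», part (2a); no definition,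
no instance, no notation, no `Prop` fact).  Plain (pro)finite group theory over abc-iut-L3's surface-type vocabulary
(`PuncturedSurfaceGroup`, `IsProSigmaCompletion`, `IsProSigmaCompletion.exists_hom_extension`,
`topologicalClosure_conjAct_smul`, `topologicalClosure_map_of_isClosedEmbedding` — consumed BY NAME), the group-theoretic
input of the sequel files `…SurfaceTypeGluing.lean`, `…TranslationCoverings.lean`, `…HatCuspIncidenceDoublyBound*.lean`,
which prove the pro-`Σ̂` edge–subgraph incidence `hF` of [IUTchI] Cor. 2.3 (vi) (GAP-LEDGER G-w4d059-g8-1) at the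
«caveat» cusps of a semi-graph of anabelioids of surface type by the TWO-LEVEL separation criterion (p507622):

* §0.1–0.2 `exists_hom_cusp_eq`, **`exists_character_cusp_eq`** — for values `val : Fin r → A` in a finite abelian
  `ℓ`-group with `∑ val = 0` (`ℓ ∈ Σ`) there is `χ : Π_v → A` with OPEN kernel and `χ(ι c_j) = val j` (the relator
  `[a₁,b₁]⋯[a_g,b_g]c₁⋯c_r` dies in an abelian group; extension along the pro-`Σ` completion);
  `apply_mem_zpowers_of_mem_conj_closure` — on the branch group `x · closure ι⟨c_j⟩ · x⁻¹` such a `χ` takes only the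
  values `χ(ι c_j)^ℤ`, and the value `χ(ι c_j)` at `x ι(c_j) x⁻¹` (`conj_generator_mem_and_apply`);
* §0.3 **`eq_closure_zpowers_pow_of_index_eq`** / `eq_of_index_eq_of_dense_zpowers` — in a Hausdorff topological group
  with a DENSE cyclic subgroup `⟨z⟩` (hence commutative, `mul_comm_of_dense_zpowers`) a CLOSED subgroup of finite index
  `ℓ` is the closure of `⟨z^ℓ⟩`, so it is unique;
* §0.4 **`exists_dense_zpowers_edgeGroup`** — the edge group `Π_e` of a branch `b` at `v` with `b_*` injective and
  `b_*(Π_e) = x · closure ι⟨c_j⟩ · x⁻¹` has a dense cyclic subgroup (`b_*` is a closed embedding; `z₀ := b_*⁻¹(x ι(c_j) x⁻¹)`).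

HONEST SCOPE: elementary lemmas; nothing of [SemiAnbd]/[IUTchI] is asserted; no side taken on [IUTchIII] Cor. 3.12;
nothing here asserts that abc is proved or refuted.
-/

noncomputable section

namespace Literature.IUT.HodgeTheaters

open _root_.Topology
open scoped Pointwise
open Literature.AnabelianGeometry.SemiGraphs
open Literature.AnabelianGeometry.SemiGraphs.SemiGraphOfAnabelioids (IsProSigmaCompletion)
open Literature.AnabelianGeometry.Anabelioids (IsSigmaInteger)
open Literature.GroupTheory.CombinatorialGroupTheory
open Literature.GroupTheory.CombinatorialGroupTheory.PuncturedSurfaceGroup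
open Multiplicative

universe u

namespace SurfaceTypeCharacters

/-! ### 0.1 Cusp characters of the punctured surface group -/

section Discrete

variable {g r : ℕ} {A : Type*} [AddCommGroup A]

/-- **Cusp characters.**  For an additive abelian group `A` and values `val : Fin r → A` with `∑_j val j = 0` there is
a homomorphism `f : Γ_{g,r} → A` (multiplicative notation) with `f(c_j) = val j` for every cusp `j` (and `f(a_i) =
f(b_i) = 0`): the relator `[a₁,b₁]⋯[a_g,b_g]·c₁⋯c_r` maps to `∑_j val j = 0`. [cite: MochizukiSemiAnbd2006, Ex. 2.10 p.31] -/
theorem exists_hom_cusp_eq (val : Fin r → A) (hval : ∑ j, val j = 0) :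
    ∃ f : PuncturedSurfaceGroup g r →* Multiplicative A, ∀ j, f (c j) = ofAdd (val j) := by
  let F : puncturedSurfaceGen g r → Multiplicative A := Sum.elim (fun _ => 1) fun j => ofAdd (val j)
  have hrel : ∀ w ∈ ({relator g r} : Set (FreeGroup (puncturedSurfaceGen g r))), FreeGroup.lift F w = 1 := by
    intro w hw
    rw [Set.mem_singleton_iff] at hw
    rw [hw, lift_relator]
    have h1 : ((List.finRange g).map fun i =>
        F (Sum.inl (i, false)) * F (Sum.inl (i, true)) * (F (Sum.inl (i, false)))⁻¹ *
          (F (Sum.inl (i, true)))⁻¹).prod = 1 :=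
      List.prod_eq_one fun y hy => by
        obtain ⟨i, -, rfl⟩ := List.mem_map.mp hy
        rw [mul_inv_cancel_comm, mul_inv_cancel]
    have h2 : ((List.finRange r).map fun j => F (Sum.inr j)).prod = 1 := by
      rw [← Fin.prod_univ_def]
      change (∏ j : Fin r, ofAdd (val j)) = 1
      rw [← ofAdd_sum, hval, ofAdd_zero]
    rw [h1, h2, one_mul]
  exact ⟨PresentedGroup.toGroup hrel, fun j => by rw [c, PresentedGroup.toGroup.of]; rfl⟩

end Discrete

/-! ### 0.2 Extension along a pro-`Σ` completion; values on the closed cusp inertia groups -/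

section Completion

variable {Sigma : Set ℕ} {g r : ℕ} {P : Type*} [Group P] [TopologicalSpace P] [IsTopologicalGroup P]
  {ι : PuncturedSurfaceGroup g r →* P}
  {A : Type*} [AddCommGroup A] [Finite A]

/-- **Cusp characters of the pro-`Σ` surface group.**  For a pro-`Σ` completion `ι : Γ_{g,r} → Π_v`, a prime
`ℓ ∈ Σ`, a finite abelian `ℓ`-group… — here: a finite abelian group `A` whose cardinality is a power of `ℓ` — and
values `val` with `∑ val = 0`, there is `χ : Π_v → A` with OPEN kernel and `χ(ι c_j) = val j`.
[cite: MochizukiSemiAnbd2006, Ex. 2.10 p.31] -/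
theorem exists_character_cusp_eq (hι : IsProSigmaCompletion Sigma ι) {ℓ : ℕ} (hℓ : ℓ.Prime) (hℓS : ℓ ∈ Sigma)
    {n : ℕ} (hA : Nat.card A = ℓ ^ n) (val : Fin r → A) (hval : ∑ j, val j = 0) :
    ∃ χ : P →* Multiplicative A, IsOpen (χ.ker : Set P) ∧ ∀ j, χ (ι (c j)) = ofAdd (val j) := by
  obtain ⟨f, hf⟩ := exists_hom_cusp_eq (g := g) val hval
  have hKS : IsSigmaInteger Sigma f.ker.index := by
    refine (IsProSigmaCompletion.isSigmaInteger_prime_pow hℓ hℓS n).of_dvd ?_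
    have h : f.ker.index ∣ Nat.card A := index_ker_dvd_card f
    rwa [hA] at h
  obtain ⟨Λ, hΛo, hΛι, -⟩ := hι.exists_hom_extension f hKS
  exact ⟨Λ, hΛo, fun j => by rw [hΛι, hf]⟩


omit [Finite A] in
/-- A homomorphism with OPEN kernel maps the closure of a subgroup into the image of the subgroup (the fibre
`y · Ker χ` is an open neighbourhood of `y`). [cite: MochizukiSemiAnbd2006, Ex. 2.10 p.31] -/
theorem apply_mem_map_of_mem_topologicalClosure (χ : P →* Multiplicative A) (hχ : IsOpen (χ.ker : Set P))
    (S : Subgroup P) {y : P} (hy : y ∈ S.topologicalClosure) : χ y ∈ S.map χ := by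
  have hopen : IsOpen ((fun z => y⁻¹ * z) ⁻¹' (χ.ker : Set P)) := hχ.preimage (continuous_const.mul continuous_id)
  have hmem : y ∈ (fun z => y⁻¹ * z) ⁻¹' (χ.ker : Set P) := by simp
  obtain ⟨s, hs, hsS⟩ := mem_closure_iff.mp hy _ hopen hmem
  have hs' : χ (y⁻¹ * s) = 1 := hs
  rw [map_mul, map_inv, inv_mul_eq_one] at hs'
  exact ⟨s, hsS, hs'.symm⟩

omit [Finite A] in
/-- **Values on a closed cusp inertia group.**  A homomorphism `χ : Π_v → A` (abelian) with open kernel maps every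
element of the branch group `x · closure ι(⟨c_j⟩) · x⁻¹` to a power of `χ(ι c_j)`. [cite: MochizukiSemiAnbd2006, Ex. 2.10 p.31] -/
theorem apply_mem_zpowers_of_mem_conj_closure (χ : P →* Multiplicative A) (hχ : IsOpen (χ.ker : Set P)) (x : P)
    (j : Fin r) {y : P}
    (hy : y ∈ ConjAct.toConjAct x • ((cuspInertia (g := g) j).map ι).topologicalClosure) :
    χ y ∈ Subgroup.zpowers (χ (ι (c j))) := by
  obtain ⟨t, ht, rfl⟩ := (Subgroup.mem_smul_pointwise_iff_exists _ _ _).mp hy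
  have hconj : χ (ConjAct.toConjAct x • t) = χ t := by
    rw [ConjAct.toConjAct_smul, map_mul, map_mul, map_inv, mul_inv_cancel_comm]
  rw [hconj]
  have h := apply_mem_map_of_mem_topologicalClosure χ hχ _ ht
  rw [Subgroup.map_map, cuspInertia, MonoidHom.map_zpowers] at h
  exact h

omit [Finite A] in
/-- The conjugated cusp generator `x · ι(c_j) · x⁻¹` lies in the branch group and `χ` takes the value `χ(ι c_j)` on
it. [cite: MochizukiSemiAnbd2006, Ex. 2.10 p.31] -/
theorem conj_generator_mem_and_apply (χ : P →* Multiplicative A) (x : P) (j : Fin r) :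
    x * ι (c j) * x⁻¹ ∈ ConjAct.toConjAct x • ((cuspInertia (g := g) j).map ι).topologicalClosure ∧
      χ (x * ι (c j) * x⁻¹) = χ (ι (c j)) := by
  refine ⟨(Subgroup.mem_smul_pointwise_iff_exists _ _ _).mpr ⟨ι (c j), Subgroup.le_topologicalClosure _
    ⟨c j, Subgroup.mem_zpowers _, rfl⟩, by rw [ConjAct.toConjAct_smul]⟩, ?_⟩
  rw [map_mul, map_mul, map_inv, mul_inv_cancel_comm]

end Completion

/-! ### 0.3 A topological group with a dense cyclic subgroup has at most one closed subgroup of each finite index -/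

section DenseCyclic

variable {Z : Type*} [Group Z] [TopologicalSpace Z] [IsTopologicalGroup Z]

/-- `S.topologicalClosure = ⊤` says that `S` is dense. [cite: MochizukiSemiAnbd2006, Ex. 2.10 p.31] -/
theorem dense_of_topologicalClosure_eq_top {S : Subgroup Z} (hS : S.topologicalClosure = ⊤) :
    Dense (S : Set Z) := by
  rw [dense_iff_closure_eq, ← Subgroup.topologicalClosure_coe, hS, Subgroup.coe_top]

/-- A Hausdorff topological group with a dense cyclic subgroup is commutative. [cite: MochizukiSemiAnbd2006, Ex. 2.10 p.31] -/
theorem mul_comm_of_dense_zpowers [T2Space Z] {z : Z} (hz : (Subgroup.zpowers z).topologicalClosure = ⊤)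
    (a b : Z) : a * b = b * a := by
  have hclosed : IsClosed {q : Z × Z | q.1 * q.2 = q.2 * q.1} :=
    isClosed_eq (continuous_fst.mul continuous_snd) (continuous_snd.mul continuous_fst)
  have h1 : Dense (Subgroup.zpowers z : Set Z) := dense_of_topologicalClosure_eq_top hz
  have hdense : Dense ((Subgroup.zpowers z : Set Z) ×ˢ (Subgroup.zpowers z : Set Z)) := h1.prod h1
  have hsub : (Subgroup.zpowers z : Set Z) ×ˢ (Subgroup.zpowers z : Set Z) ⊆ {q : Z × Z | q.1 * q.2 = q.2 * q.1} := by
    rintro ⟨_, _⟩ ⟨⟨m, rfl⟩, ⟨n, rfl⟩⟩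
    exact zpow_mul_comm z m n
  have hall : {q : Z × Z | q.1 * q.2 = q.2 * q.1} = Set.univ :=
    Set.eq_univ_of_univ_subset ((hdense.closure_eq ▸ closure_mono hsub).trans hclosed.closure_subset)
  have : (a, b) ∈ {q : Z × Z | q.1 * q.2 = q.2 * q.1} := by rw [hall]; trivial
  exact this

/-- With a dense cyclic subgroup `⟨z⟩`, every element lies in `z^i · W` for some `i < ℓ`, where `W` is the closure of
`⟨z^ℓ⟩` (`ℓ ≥ 1`): the finite union of these closed cosets contains `⟨z⟩`. [cite: MochizukiSemiAnbd2006, Ex. 2.10 p.31] -/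
theorem exists_mem_zpow_mul_closure {z : Z} (hz : (Subgroup.zpowers z).topologicalClosure = ⊤) {ℓ : ℕ}
    (hℓ : 0 < ℓ) (y : Z) :
    ∃ i : ℕ, i < ℓ ∧ y ∈ z ^ i • ((Subgroup.zpowers (z ^ ℓ)).topologicalClosure : Set Z) := by
  set W : Subgroup Z := (Subgroup.zpowers (z ^ ℓ)).topologicalClosure
  have hWc : IsClosed (W : Set Z) := Subgroup.isClosed_topologicalClosure _
  -- the finite union of the closed cosets `z^i W`
  have hUc : IsClosed (⋃ i ∈ Finset.range ℓ, z ^ i • (W : Set Z)) :=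
    Set.Finite.isClosed_biUnion (Finset.range ℓ).finite_toSet fun i _ => hWc.smul (z ^ i)
  have hsub : (Subgroup.zpowers z : Set Z) ⊆ ⋃ i ∈ Finset.range ℓ, z ^ i • (W : Set Z) := by
    rintro _ ⟨m, rfl⟩
    have hℓ' : (ℓ : ℤ) ≠ 0 := by exact_mod_cast hℓ.ne'
    refine Set.mem_biUnion (Finset.mem_coe.mpr (Finset.mem_range.mpr ?_) :
      (m % ℓ).toNat ∈ (Finset.range ℓ : Set ℕ)) ?_
    · have h0 : 0 ≤ m % ℓ := Int.emod_nonneg _ hℓ'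
      have h1 : m % ℓ < ℓ := Int.emod_lt_of_pos _ (by exact_mod_cast hℓ)
      omega
    · refine Set.mem_smul_set.mpr ⟨(z ^ ℓ) ^ (m / ℓ), Subgroup.le_topologicalClosure _ ⟨m / ℓ, rfl⟩, ?_⟩
      rw [smul_eq_mul, ← zpow_natCast z, Int.toNat_of_nonneg (Int.emod_nonneg _ hℓ'), ← zpow_natCast,
        ← zpow_mul, ← zpow_add, Int.emod_add_mul_ediv]
  have hall : (⋃ i ∈ Finset.range ℓ, z ^ i • (W : Set Z)) = Set.univ :=
    Set.eq_univ_of_univ_subset (((dense_of_topologicalClosure_eq_top hz).closure_eq ▸ closure_mono hsub).trans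
      hUc.closure_subset)
  have hy : y ∈ ⋃ i ∈ Finset.range ℓ, z ^ i • (W : Set Z) := by rw [hall]; trivial
  obtain ⟨i, hi, hyi⟩ := Set.mem_iUnion₂.mp hy
  exact ⟨i, Finset.mem_range.mp (Finset.mem_coe.mp hi), hyi⟩

/-- **Uniqueness of the closed subgroup of index `ℓ`.**  In a Hausdorff topological group with a dense cyclic
subgroup `⟨z⟩`, a CLOSED subgroup of finite index `ℓ ≥ 1` is the closure of `⟨z^ℓ⟩`; in particular it is unique.
[cite: MochizukiSemiAnbd2006, Ex. 2.10 p.31] -/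
theorem eq_closure_zpowers_pow_of_index_eq [T2Space Z] {z : Z}
    (hz : (Subgroup.zpowers z).topologicalClosure = ⊤) {ℓ : ℕ} (hℓ : 0 < ℓ) (U : Subgroup Z)
    (hUc : IsClosed (U : Set Z)) (hUi : U.index = ℓ) : U = (Subgroup.zpowers (z ^ ℓ)).topologicalClosure := by
  set W : Subgroup Z := (Subgroup.zpowers (z ^ ℓ)).topologicalClosure
  -- `W ≤ U`: `z^ℓ = z^[Z:U] ∈ U` (every subgroup is normal, `Z` being commutative)
  haveI : U.Normal := ⟨fun n hn g => by rwa [mul_comm_of_dense_zpowers hz g n, mul_inv_cancel_right]⟩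
  have hWU : W ≤ U := by
    refine Subgroup.topologicalClosure_minimal _ ((Subgroup.zpowers_le).mpr ?_) hUc
    rw [← hUi]
    exact U.pow_index_mem z
  -- `[Z : W] ≤ ℓ`: the cosets `z^i W`, `i < ℓ`, exhaust `Z`
  have hsurj : Function.Surjective fun i : Fin ℓ => ((z ^ (i : ℕ) : Z) : Z ⧸ W) := by
    intro q
    induction q using QuotientGroup.induction_on with
    | H y =>
      obtain ⟨i, hi, hyi⟩ := exists_mem_zpow_mul_closure hz hℓ y
      obtain ⟨w, hw, rfl⟩ := Set.mem_smul_set.mp hyi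
      have hw' : w ∈ W := hw
      exact ⟨⟨i, hi⟩, (QuotientGroup.eq.mpr (by simpa using hw')).symm⟩
  haveI : Finite (Z ⧸ W) := Finite.of_surjective _ hsurj
  have hWi : W.index ≤ ℓ := by
    rw [Subgroup.index_eq_card]
    simpa using Nat.card_le_card_of_surjective _ hsurj
  have hWi0 : W.index ≠ 0 := Subgroup.index_ne_zero_of_finite
  -- hence `U = W`
  refine le_antisymm ?_ hWU
  have hmul := Subgroup.relIndex_mul_index hWU
  rw [hUi] at hmul
  have hrel : W.relIndex U = 1 := by
    have h1 : W.relIndex U * ℓ ≤ 1 * ℓ := by rw [hmul, one_mul]; exact hWi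
    have h2 : W.relIndex U ≤ 1 := Nat.le_of_mul_le_mul_right h1 hℓ
    have h3 : W.relIndex U ≠ 0 := fun h => hWi0 (by rw [← hmul, h, zero_mul])
    omega
  exact Subgroup.relIndex_eq_one.mp hrel

/-- Two closed subgroups of the same finite index `ℓ ≥ 1` coincide (dense cyclic subgroup, Hausdorff). [cite: MochizukiSemiAnbd2006, Ex. 2.10 p.31] -/
theorem eq_of_index_eq_of_dense_zpowers [T2Space Z] {z : Z} (hz : (Subgroup.zpowers z).topologicalClosure = ⊤)
    {ℓ : ℕ} (hℓ : 0 < ℓ) (U V : Subgroup Z) (hUc : IsClosed (U : Set Z)) (hVc : IsClosed (V : Set Z))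
    (hUi : U.index = ℓ) (hVi : V.index = ℓ) : U = V := by
  rw [eq_closure_zpowers_pow_of_index_eq hz hℓ U hUc hUi, eq_closure_zpowers_pow_of_index_eq hz hℓ V hVc hVi]

end DenseCyclic


/-! ### 0.4 The edge group behind a surface-type branch has a dense cyclic subgroup -/

section EdgeGroup

variable {𝒢 : ProfiniteSemiGraph.{u}} {g r : ℕ}

/-- The conjugated cusp generator `x · ι(c_j) · x⁻¹` lies in `x · closure ι(⟨c_j⟩) · x⁻¹`.
[cite: MochizukiSemiAnbd2006, Ex. 2.10 p.31] -/
theorem conj_generator_mem {P : Type*} [Group P] [TopologicalSpace P] [IsTopologicalGroup P]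
    (ι : PuncturedSurfaceGroup g r →* P) (x : P) (j : Fin r) :
    x * ι (c j) * x⁻¹ ∈ ConjAct.toConjAct x • ((cuspInertia (g := g) j).map ι).topologicalClosure :=
  (Subgroup.mem_smul_pointwise_iff_exists _ _ _).mpr ⟨ι (c j), Subgroup.le_topologicalClosure _
    ⟨c j, Subgroup.mem_zpowers _, rfl⟩, by rw [ConjAct.toConjAct_smul]⟩

/-- **The edge group of a surface-type branch is topologically cyclic.**  If `b` abuts to `v`, `b_* : Π_e → Π_v` is
injective and the branch group `b_*(Π_e)` is the conjugate `x · closure ι(⟨c_j⟩) · x⁻¹` of a closed cusp inertia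
group of a surface structure `ι : Γ_{g,r} → Π_v`, then the element `z₀ := b_*⁻¹(x ι(c_j) x⁻¹)` of `Π_e` generates a
DENSE cyclic subgroup (`b_*` is a closed embedding). [cite: MochizukiSemiAnbd2006, Ex. 2.10 p.31] -/
theorem exists_dense_zpowers_edgeGroup (b : 𝒢.graph.Branch) (v : 𝒢.graph.Vertex) (h : 𝒢.graph.abuts b = some v)
    (hinj : Function.Injective (𝒢.brHom b v h)) (ι : PuncturedSurfaceGroup g r →* 𝒢.Gv v) (x : 𝒢.Gv v)
    (j : Fin r)
    (hB : 𝒢.branchSubgroup b v h = ConjAct.toConjAct x • ((cuspInertia (g := g) j).map ι).topologicalClosure) :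
    ∃ z₀ : 𝒢.Ge (𝒢.graph.edgeOf b), 𝒢.brHom b v h z₀ = x * ι (c j) * x⁻¹ ∧
      (Subgroup.zpowers z₀).topologicalClosure = ⊤ := by
  have hmem : x * ι (c j) * x⁻¹ ∈ 𝒢.branchSubgroup b v h := by rw [hB]; exact conj_generator_mem ι x j
  obtain ⟨z₀, hz₀⟩ := hmem
  refine ⟨z₀, hz₀, ?_⟩
  have hf : IsClosedEmbedding (𝒢.brHom b v h).toMonoidHom := (𝒢.brHom b v h).continuous.isClosedEmbedding hinj
  -- `b_*(closure ⟨z₀⟩) = closure ⟨x ι(c_j) x⁻¹⟩ = x · closure ι⟨c_j⟩ · x⁻¹ = b_*(Π_e)`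
  have hzp : (Subgroup.zpowers z₀).map (𝒢.brHom b v h).toMonoidHom =
      ConjAct.toConjAct x • (cuspInertia (g := g) j).map ι := by
    rw [MonoidHom.map_zpowers, cuspInertia, MonoidHom.map_zpowers, Subgroup.pointwise_smul_def,
      MonoidHom.map_zpowers]
    change Subgroup.zpowers ((𝒢.brHom b v h).toMonoidHom z₀) = Subgroup.zpowers (ConjAct.toConjAct x • ι (c j))
    rw [hz₀, ConjAct.toConjAct_smul]
  have hcl : (Subgroup.zpowers z₀).topologicalClosure.map (𝒢.brHom b v h).toMonoidHom =
      (⊤ : Subgroup _).map (𝒢.brHom b v h).toMonoidHom := by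
    rw [← topologicalClosure_map_of_isClosedEmbedding _ hf, hzp, topologicalClosure_conjAct_smul, ← hB,
      ProfiniteSemiGraph.branchSubgroup, ← MonoidHom.range_eq_map]
  exact Subgroup.map_injective hinj hcl

end EdgeGroup

end SurfaceTypeCharacters

end Literature.IUT.HodgeTheaters
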